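/-
Copyright (c) 2026. All rights reserved.
Released under Apache 2.0 license as described in the file LICENSE.
-/
import Literature.NumberTheory.GaloisRepresentations.TateDualityZeroTwoLeft
import HarnessLib

/-!
# Local Tate duality in bidegree `(2, 0)`: surjectivity onto `Hom(H²(G, M), ℤ/n)` by dévissage

Serre, *Cohomologie galoisienne*, II §5.2 Thm. 2 (Tate), case `i = 2`: for a finite module
`M` over a `p`-adic field, `H²(k, M)` is dual to `H⁰(k, M^D)`.  This file proves, on Mathlib's
continuous cohomology and for an arbitrary locally compact group `G`, a discrete `Ω ≃ ℤ/n` and an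
additive `ι : H²(G, Ω) → ℤ/n`, the **abstract dévissage for the surjectivity of**

  `γ_M : (M^D)^G → Hom(H²(G, M), ℤ/n)`,  `f ↦ (z ↦ ι(H²(ev_f) z))`  (`ContinuousRep.twoZero`),

(`ev_f : M → Ω` the equivariant map `m ↦ f m`), i.e. every additive `λ : H²(G, M) → ℤ/n` is
`⟨·, f⟩` for an invariant `f ∈ Hom_G(M, Ω)` (`twoZero_surjective_of_devissage`).  Together with
the injectivity of `f ↦ ⟨·, f⟩` (the `(0, 2)` left kernel of `TateDualityZeroTwoLeft.lean` for
`M^D`) this yields `|H²(G, M)| = |Hom_G(M, Ω)|` over local fields (`LocalDualityTwoZero.lean`).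

The induction on `|M|` runs through `0 → N →ⁱ M →π W → 0`, `W = M/N ≅ ℤ/p` trivial
(`exists_quotient_line`), and the dual `0 → W^D → M^D → N^D → 0`, chasing the diagram

  `0 → (W^D)^G → (M^D)^G → (N^D)^G →δ₀ H¹(G, W^D)`
  `0 → Hom(H²W) → Hom(H²M) → Hom(H²N) →(δ₁)^* Hom(H¹W)`

whose only non-formal square is `⟨x, δ₀ f⟩₁₁ = ⟨δ₁ x, f⟩₂₀` (`dualityPairing_δ₀_eq_twoZero_δ₁`,
from the tree's `cupProduct_δ₀_eq_neg_map_δ₁` for the flipped pairings and `cupProduct_comm`):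
given `λ`, the induction hypothesis writes `λ ∘ i_* = γ_N f`; then `δ₀ f` pairs to zero with
`H¹(G, W)` (as `i_* ∘ δ₁ = 0`), so `δ₀ f = 0` by the right non-degeneracy of `H¹(W) × H¹(W^D)` for
the line, `f = f_M|_N`, and `λ - γ_M f_M` factors through `H²(G, W)` (`π_*` is onto as
`H³(G, N) = 0`), where the line case applies.  Also: finiteness of `H²(G, M)` by the same
dévissage (`finite_two_of_devissage`).

## References
* J.-P. Serre, *Galois Cohomology*, Springer, 1997, II §5.2 Thm. 2 (proof). [SerreGaloisCohomology1997]
* J. S. Milne, *Arithmetic Duality Theorems*, 2006, I Cor. 2.3 and Thm. 2.1 (diagram). [MilneADT2006]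
-/

noncomputable section

open CategoryTheory Function

universe u

namespace Literature.NumberTheory.GaloisRepresentations

open _root_.TopRep _root_.ContRepresentation _root_.ContinuousCohomology

namespace ContinuousRep

section TwoZero

variable {G : Type u} [Group G] [TopologicalSpace G] [IsTopologicalGroup G] [LocallyCompactSpace G]
variable {Ω : Type u} [AddCommGroup Ω] [TopologicalSpace Ω] [DiscreteTopology Ω] {n : ℕ}
variable {M : Type u} [AddCommGroup M] [TopologicalSpace M] [DiscreteTopology M] [Finite M]

/-- **The degree `(2, 0)` pairing with an invariant `f ∈ M^D = Hom(M, Ω)`**: `z ↦ ι(H²(ev_f) z)`,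
`H²(G, M) → ℤ/n`, where `ev_f : M → Ω`, `m ↦ f m` is `ContPairing.leftHom` of the flipped evaluation
pairing. [cite: SerreGaloisCohomology1997, II §5.2 Thm. 2] -/
def twoZero (ρ : ContinuousRep G ℤ M) (ω : ContinuousRep G ℤ Ω)
    (ι : continuousCohomology 2 ω.toTopRep →+ ZMod n) (f : HomCarrier M Ω) (hf : ∀ g : G, ρ.homRep ω g f = f) :
    continuousCohomology 2 ρ.toTopRep →+ ZMod n :=
  ι.comp (cohomologyMap ((ρ.evalPairing ω).flip.leftHom f hf) 2).hom.toLinearMap.toAddMonoidHom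

omit [LocallyCompactSpace G] in
/-- Unfolding `twoZero`. [folklore] -/
@[simp] theorem twoZero_apply (ρ : ContinuousRep G ℤ M) (ω : ContinuousRep G ℤ Ω)
    (ι : continuousCohomology 2 ω.toTopRep →+ ZMod n) (f : HomCarrier M Ω) (hf : ∀ g : G, ρ.homRep ω g f = f)
    (z : continuousCohomology 2 ρ.toTopRep) :
    ρ.twoZero ω ι f hf z = ι (cohomologyMap ((ρ.evalPairing ω).flip.leftHom f hf) 2 z) := rfl

/-- `twoZero` is additive in `f`. [folklore] -/
theorem twoZero_add (ρ : ContinuousRep G ℤ M) (ω : ContinuousRep G ℤ Ω)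
    (ι : continuousCohomology 2 ω.toTopRep →+ ZMod n) (f f' : HomCarrier M Ω) (hf : ∀ g : G, ρ.homRep ω g f = f)
    (hf' : ∀ g : G, ρ.homRep ω g f' = f') (hff : ∀ g : G, ρ.homRep ω g (f + f') = f + f')
    (z : continuousCohomology 2 ρ.toTopRep) :
    ρ.twoZero ω ι (f + f') hff z = ρ.twoZero ω ι f hf z + ρ.twoZero ω ι f' hf' z := by
  obtain ⟨c, rfl⟩ := twoCocycleClass_surjective _ z
  rw [twoZero_apply, twoZero_apply, twoZero_apply, cohomologyMap_twoCocycleClass,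
    cohomologyMap_twoCocycleClass, cohomologyMap_twoCocycleClass, ← map_add, ← twoCocycleClass_add]
  exact congrArg (fun y => ι (twoCocycleClass _ y)) (Subtype.ext (ContinuousMap.ext fun _ => rfl))

/-- **Naturality of the `(2, 0)` pairing**: for an equivariant `φ : M₁ → M₂` and an invariant
`f ∈ M₂^D`, `⟨H²(φ) z, f⟩ = ⟨z, φ^D f⟩`. [folklore] -/
theorem twoZero_map {M₁ : Type u} [AddCommGroup M₁] [TopologicalSpace M₁] [DiscreteTopology M₁] [Finite M₁]
    {ρ₁ : ContinuousRep G ℤ M₁} {ρ : ContinuousRep G ℤ M} (ω : ContinuousRep G ℤ Ω)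
    (ι : continuousCohomology 2 ω.toTopRep →+ ZMod n) (φ : ρ₁.toTopRep ⟶ ρ.toTopRep)
    (f : HomCarrier M Ω) (hf : ∀ g : G, ρ.homRep ω g f = f)
    (hφf : ∀ g : G, ρ₁.homRep ω g ((homRepMap ω φ).hom f) = (homRepMap ω φ).hom f)
    (z : continuousCohomology 2 ρ₁.toTopRep) :
    ρ.twoZero ω ι f hf (cohomologyMap φ 2 z) = ρ₁.twoZero ω ι ((homRepMap ω φ).hom f) hφf z := by
  obtain ⟨c, rfl⟩ := twoCocycleClass_surjective _ z
  rw [twoZero_apply, twoZero_apply, cohomologyMap_twoCocycleClass, cohomologyMap_twoCocycleClass,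
    cohomologyMap_twoCocycleClass]
  exact congrArg (fun y => ι (twoCocycleClass _ y)) (Subtype.ext (ContinuousMap.ext fun _ => rfl))

omit [LocallyCompactSpace G] [TopologicalSpace Ω] [DiscreteTopology Ω] [TopologicalSpace M] [DiscreteTopology M]
  [Finite M] in
/-- The pull-back `φ^D f` of an invariant `f` is invariant. [folklore] -/
theorem homRepMap_invariant {M₁ : Type u} [AddCommGroup M₁] [TopologicalSpace M₁] [DiscreteTopology M₁] [Finite M₁]
    [TopologicalSpace Ω] [DiscreteTopology Ω] [TopologicalSpace M] [DiscreteTopology M] [Finite M]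
    {ρ₁ : ContinuousRep G ℤ M₁} {ρ : ContinuousRep G ℤ M} (ω : ContinuousRep G ℤ Ω)
    (φ : ρ₁.toTopRep ⟶ ρ.toTopRep) (f : HomCarrier M Ω) (hf : ∀ g : G, ρ.homRep ω g f = f) (g : G) :
    ρ₁.homRep ω g ((homRepMap ω φ).hom f) = (homRepMap ω φ).hom f :=
  (TopRep.hom_comm_apply (homRepMap ω φ) g f).symm.trans (congrArg _ (hf g))

end TwoZero

/-! ### The non-formal square: `⟨x, δ₀ f⟩₁₁ = ⟨δ₁ x, f⟩₂₀` -/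

section Square

variable {G : Type u} [Group G] [TopologicalSpace G] [IsTopologicalGroup G] [LocallyCompactSpace G]
variable {Ω : Type u} [AddCommGroup Ω] [TopologicalSpace Ω] [DiscreteTopology Ω] {n : ℕ}
variable {M : Type u} [AddCommGroup M] [TopologicalSpace M] [DiscreteTopology M] [Finite M]
variable (ρ : ContinuousRep G ℤ M) (ω : ContinuousRep G ℤ Ω) (ι : continuousCohomology 2 ω.toTopRep →+ ZMod n)
variable (N : Submodule ℤ M) (hN : ∀ g, N ≤ N.comap (ρ g))

/-- **Compatibility of the `(1, 1)` and `(2, 0)` pairings with the connecting maps**: for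
`0 → N → M → M/N → 0` with dual `0 → (M/N)^D → M^D → N^D → 0`, an invariant `f ∈ (N^D)^G` and
`x ∈ H¹(G, M/N)`, `ι(x ∪ δ₀ f) = ι(H²(ev_f)(δ₁ x))` (the tree's `cupProduct_δ₀_eq_neg_map_δ₁` for the
flipped pairings, and graded commutativity `cupProduct_comm`).
[cite: NeukirchSchmidtWingberg2008, I §4 (1.4.3), (1.4.4)] [cite: MilneADT2006, I Thm. 2.1 (diagram)] -/
theorem dualityPairing_δ₀_eq_twoZero_δ₁ [NeZero n] (eΩ : Ω ≃+ ZMod n) (hM : ∀ m : M, n • m = 0)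
    (f : HomCarrier N Ω) (hf : ∀ g : G, (ρ.subrepresentation N hN).homRep ω g f = f)
    (x : continuousCohomology 1 (ρ.quotient N hN).toTopRep) :
    (ρ.quotient N hN).dualityPairing ω ι x
        ((isSES_homRepMap_mkQ_subtype ρ ω N hN eΩ hM).δ₀ ⟨f, hf⟩) =
      (ρ.subrepresentation N hN).twoZero ω ι f hf ((isSES_subtype_mkQ ρ N hN).δ₁ x) := by
  set hSES₁ := isSES_subtype_mkQ ρ N hN
  set hSES₂ := isSES_homRepMap_mkQ_subtype ρ ω N hN eΩ hM
  have ec := cupProduct_δ₀_eq_neg_map_δ₁ hSES₂ hSES₁ (ρ.evalPairing ω).flip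
    ((ρ.quotient N hN).evalPairing ω).flip ((ρ.subrepresentation N hN).evalPairing ω).flip
    (fun _ _ => rfl) (fun _ _ => rfl) ⟨f, hf⟩ x
  rw [dualityPairing_apply, ContPairing.cupProduct_comm]
  refine (congrArg (fun t => ι (-t)) ec).trans ?_
  rw [neg_neg, twoZero_apply]

end Square

/-! ### The dévissage -/

section Devissage

variable {G : Type u} [Group G] [TopologicalSpace G] [IsTopologicalGroup G] [LocallyCompactSpace G]
variable {Ω : Type u} [AddCommGroup Ω] [TopologicalSpace Ω] [DiscreteTopology Ω]

/-- **Finiteness of `H²(G, M)` by dévissage**: if `H²(G, W)` is finite for every `W` of order `p`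
with trivial action, then `H²(G, M)` is finite for every finite `p`-primary `M` on which `N₀`
(`G/N₀` a finite `p`-group) acts trivially (exactness of `H²(N) → H²(M) → H²(M/N)`).
[cite: SerreGaloisCohomology1997, II §5.2 Prop. 14 (proof)] -/
theorem finite_two_of_devissage {p : ℕ} [hp : Fact p.Prime] (N₀ : Subgroup G) [N₀.Normal] [Finite (G ⧸ N₀)]
    (hQ : IsPGroup p (G ⧸ N₀))
    (hline : ∀ (W : Type u) [AddCommGroup W] [TopologicalSpace W] [DiscreteTopology W] [Finite W]
      (τ : ContinuousRep G ℤ W), (∀ (g : G) (w : W), τ g w = w) → Nat.card W = p →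
      Finite (continuousCohomology 2 τ.toTopRep))
    (M : Type u) [AddCommGroup M] [TopologicalSpace M] [DiscreteTopology M] [Finite M]
    (ρ : ContinuousRep G ℤ M) (hpM : IsPrimaryTorsion p M) (hN₀ : ∀ g ∈ N₀, ∀ m : M, ρ g m = m) :
    Finite (continuousCohomology 2 ρ.toTopRep) := by
  classical
  suffices key : ∀ (k : ℕ) (M : Type u) [AddCommGroup M] [TopologicalSpace M] [DiscreteTopology M]
      [Finite M] (ρ : ContinuousRep G ℤ M), IsPrimaryTorsion p M → (∀ g ∈ N₀, ∀ m : M, ρ g m = m) →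
      Nat.card M = k → Finite (continuousCohomology 2 ρ.toTopRep) from key _ M ρ hpM hN₀ rfl
  intro k
  induction k using Nat.strong_induction_on with
  | _ k ih =>
  intro M _ _ _ _ ρ hpM hN₀ hk
  by_cases hsub : Subsingleton M
  · haveI := subsingleton_continuousCohomology_of_subsingleton ρ.toTopRep 1
    infer_instance
  haveI : Nontrivial M := not_subsingleton_iff_nontrivial.1 hsub
  obtain ⟨N, hN, hcard, htriv⟩ := exists_quotient_line N₀ hQ ρ hpM hN₀
  have hSES₁ : IsSES (subtypeHom ρ N hN) (ρ.mkQHom N hN) := isSES_subtype_mkQ ρ N hN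
  have hNcard : Nat.card N < k := by
    have hmul : Nat.card M = Nat.card N * Nat.card (M ⧸ N) := Submodule.card_eq_card_quotient_mul_card N
    rw [hk, hcard] at hmul
    rw [hmul]
    exact (Nat.lt_mul_iff_one_lt_right Nat.card_pos).2 hp.out.one_lt
  have hNN₀ : ∀ g ∈ N₀, ∀ x : N, ρ.subrepresentation N hN g x = x := fun g hg x =>
    Subtype.ext (by rw [subrepresentation_apply_coe, hN₀ g hg])
  haveI : Finite (continuousCohomology 2 (ρ.subrepresentation N hN).toTopRep) :=
    ih _ hNcard N (ρ.subrepresentation N hN) (hpM.submodule N) hNN₀ rfl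
  haveI : Finite (continuousCohomology 2 (ρ.quotient N hN).toTopRep) := hline (M ⧸ N) (ρ.quotient N hN) htriv hcard
  haveI := Fintype.ofFinite (continuousCohomology 2 (ρ.subrepresentation N hN).toTopRep)
  haveI := Fintype.ofFinite (continuousCohomology 2 (ρ.quotient N hN).toTopRep)
  letI : Fintype (continuousCohomology 2 ρ.toTopRep) :=
    AddGroup.fintypeOfKerLeRange (cohomologyMap (subtypeHom ρ N hN) 2).hom.toLinearMap.toAddMonoidHom
      (cohomologyMap (ρ.mkQHom N hN) 2).hom.toLinearMap.toAddMonoidHom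
      fun b hb => hSES₁.exists_map_two_eq_of_map_two_eq_zero b hb
  exact Finite.of_fintype _

/-- **Local Tate duality in bidegree `(2, 0)`, the dévissage for the surjectivity of
`(M^D)^G → Hom(H²(G, M), ℤ/n)`** (Serre II §5.2, proof of Thm. 2, `i = 2`): see the module
docstring.  Hypotheses on lines `W` of order `p` with trivial action: (2,0) every additive
`H²(G, W) → ℤ/n` is `⟨·, h⟩` for an invariant `h ∈ W^D`; (1,1) the right kernel of
`H¹(G, W) × H¹(G, W^D) → ℤ/n` is trivial; and `H³(G, X) = 0` for the finite `p`-primary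
`N₀`-trivial `X` (`cd_p ≤ 2`).
[cite: SerreGaloisCohomology1997, II §5.2 Thm. 2 (proof)] [cite: MilneADT2006, I Cor. 2.3] -/
theorem twoZero_surjective_of_devissage (ω : ContinuousRep G ℤ Ω) {n : ℕ} [NeZero n]
    (eΩ : Ω ≃+ ZMod n) (ι : continuousCohomology 2 ω.toTopRep →+ ZMod n) {p : ℕ} [hp : Fact p.Prime]
    (N₀ : Subgroup G) [N₀.Normal] [Finite (G ⧸ N₀)] (hQ : IsPGroup p (G ⧸ N₀))
    (hline : ∀ (W : Type u) [AddCommGroup W] [TopologicalSpace W] [DiscreteTopology W] [Finite W]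
      (τ : ContinuousRep G ℤ W), (∀ (g : G) (w : W), τ g w = w) → Nat.card W = p →
      ∀ μ : continuousCohomology 2 τ.toTopRep →+ ZMod n,
        ∃ (h : HomCarrier W Ω) (hh : ∀ g : G, τ.homRep ω g h = h), τ.twoZero ω ι h hh = μ)
    (h11r : ∀ (W : Type u) [AddCommGroup W] [TopologicalSpace W] [DiscreteTopology W] [Finite W]
      (τ : ContinuousRep G ℤ W), (∀ (g : G) (w : W), τ g w = w) → Nat.card W = p →
      ∀ b : continuousCohomology 1 (τ.homRep ω).toTopRep,
        (∀ x : continuousCohomology 1 τ.toTopRep, τ.dualityPairing ω ι x b = 0) → b = 0)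
    (h3 : ∀ (X : Type u) [AddCommGroup X] [TopologicalSpace X] [DiscreteTopology X] [Finite X]
      (τ : ContinuousRep G ℤ X), IsPrimaryTorsion p X → (∀ g ∈ N₀, ∀ x : X, τ g x = x) →
      Subsingleton (continuousCohomology 3 τ.toTopRep))
    (M : Type u) [AddCommGroup M] [TopologicalSpace M] [DiscreteTopology M] [Finite M]
    (ρ : ContinuousRep G ℤ M) (hpM : IsPrimaryTorsion p M) (hM : ∀ m : M, n • m = 0)
    (hN₀ : ∀ g ∈ N₀, ∀ m : M, ρ g m = m) (lam : continuousCohomology 2 ρ.toTopRep →+ ZMod n) :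
    ∃ (f : HomCarrier M Ω) (hf : ∀ g : G, ρ.homRep ω g f = f), ρ.twoZero ω ι f hf = lam := by
  classical
  suffices key : ∀ (k : ℕ) (M : Type u) [AddCommGroup M] [TopologicalSpace M] [DiscreteTopology M]
      [Finite M] (ρ : ContinuousRep G ℤ M), IsPrimaryTorsion p M → (∀ m : M, n • m = 0) →
      (∀ g ∈ N₀, ∀ m : M, ρ g m = m) → Nat.card M = k → ∀ lam : continuousCohomology 2 ρ.toTopRep →+ ZMod n,
      ∃ (f : HomCarrier M Ω) (hf : ∀ g : G, ρ.homRep ω g f = f), ρ.twoZero ω ι f hf = lam from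
    key _ M ρ hpM hM hN₀ rfl lam
  intro k
  induction k using Nat.strong_induction_on with
  | _ k ih =>
  intro M _ _ _ _ ρ hpM hM hN₀ hk lam
  by_cases hsub : Subsingleton M
  · haveI := subsingleton_continuousCohomology_of_subsingleton ρ.toTopRep 1
    refine ⟨0, fun g => map_zero _, AddMonoidHom.ext fun z => ?_⟩
    rw [Subsingleton.elim z 0, map_zero, map_zero]
  haveI : Nontrivial M := not_subsingleton_iff_nontrivial.1 hsub
  obtain ⟨N, hN, hcard, htriv⟩ := exists_quotient_line N₀ hQ ρ hpM hN₀
  -- the two short exact sequences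
  have hSES₁ : IsSES (subtypeHom ρ N hN) (ρ.mkQHom N hN) := isSES_subtype_mkQ ρ N hN
  have hSES₂ : IsSES (homRepMap ω (ρ.mkQHom N hN)) (homRepMap ω (subtypeHom ρ N hN)) :=
    isSES_homRepMap_mkQ_subtype ρ ω N hN eΩ hM
  -- bookkeeping for `N` and `M/N`
  have hNcard : Nat.card N < k := by
    have hmul : Nat.card M = Nat.card N * Nat.card (M ⧸ N) := Submodule.card_eq_card_quotient_mul_card N
    rw [hk, hcard] at hmul
    rw [hmul]
    exact (Nat.lt_mul_iff_one_lt_right Nat.card_pos).2 hp.out.one_lt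
  have hNn : ∀ x : N, n • x = 0 := fun x => Subtype.ext (by simp [hM])
  have hNN₀ : ∀ g ∈ N₀, ∀ x : N, ρ.subrepresentation N hN g x = x := fun g hg x =>
    Subtype.ext (by rw [subrepresentation_apply_coe, hN₀ g hg])
  have hQN₀ : ∀ g ∈ N₀, ∀ q : M ⧸ N, ρ.quotient N hN g q = q := fun g _ q => htriv g q
  haveI := h3 N (ρ.subrepresentation N hN) (hpM.submodule N) hNN₀
  -- Step 1: `λ ∘ i_* = γ_N f` by induction
  let lamN : continuousCohomology 2 (ρ.subrepresentation N hN).toTopRep →+ ZMod n :=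
    lam.comp (cohomologyMap (subtypeHom ρ N hN) 2).hom.toLinearMap.toAddMonoidHom
  obtain ⟨f, hf, hfN⟩ := ih _ hNcard N (ρ.subrepresentation N hN) (hpM.submodule N) hNn hNN₀ rfl lamN
  -- Step 2: `δ₀ f = 0` by the right non-degeneracy of `H¹(W) × H¹(W^D)` for the line `W = M/N`
  have hδf : hSES₂.δ₀ ⟨f, hf⟩ = 0 := by
    refine h11r (M ⧸ N) (ρ.quotient N hN) htriv hcard _ fun x => ?_
    rw [dualityPairing_δ₀_eq_twoZero_δ₁ ρ ω ι N hN eΩ hM f hf x, hfN]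
    change lam (cohomologyMap (subtypeHom ρ N hN) 2 (hSES₁.δ₁ x)) = 0
    rw [hSES₁.map_two_δ₁, map_zero]
  obtain ⟨fM, hfM, hfMf⟩ := (hSES₂.δ₀_eq_zero_iff ⟨f, hf⟩).1 hδf
  have hfMf' : (homRepMap ω (subtypeHom ρ N hN)).hom fM = f := hfMf
  -- Step 3: `λ' = λ - γ_M f_M` vanishes on the image of `H²(N)`, hence factors through `H²(M/N)`
  set lam' := lam - ρ.twoZero ω ι fM hfM with hlam'
  have h3a : ∀ z, lam' (cohomologyMap (subtypeHom ρ N hN) 2 z) = 0 := fun z => by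
    rw [hlam', AddMonoidHom.sub_apply, sub_eq_zero,
      twoZero_map ω ι (subtypeHom ρ N hN) fM hfM (homRepMap_invariant ω (subtypeHom ρ N hN) fM hfM) z]
    have e : (ρ.subrepresentation N hN).twoZero ω ι ((homRepMap ω (subtypeHom ρ N hN)).hom fM)
        (homRepMap_invariant ω (subtypeHom ρ N hN) fM hfM) = (ρ.subrepresentation N hN).twoZero ω ι f hf := by
      simp_rw [hfMf']
    rw [e, hfN]
    rfl
  have h3b : ∀ y y', cohomologyMap (ρ.mkQHom N hN) 2 y = cohomologyMap (ρ.mkQHom N hN) 2 y' → lam' y = lam' y' := by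
    intro y y' hyy
    obtain ⟨z, hz⟩ := hSES₁.exists_map_two_eq_of_map_two_eq_zero (y - y') (by rw [map_sub, hyy, sub_self])
    rw [← sub_eq_zero, ← map_sub, ← hz]
    exact h3a z
  have hsurj : Surjective (cohomologyMap (ρ.mkQHom N hN) 2) := hSES₁.exists_map_two_eq_of_subsingleton_three
  let lam'' : continuousCohomology 2 (ρ.quotient N hN).toTopRep →+ ZMod n :=
    { toFun := fun u => lam' (surjInv hsurj u)
      map_zero' := by
        rw [h3b (surjInv hsurj 0) 0 (by rw [surjInv_eq hsurj, map_zero]), map_zero]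
      map_add' := fun u v => by
        rw [← map_add, h3b (surjInv hsurj (u + v)) (surjInv hsurj u + surjInv hsurj v)
          (by rw [map_add, surjInv_eq hsurj, surjInv_eq hsurj, surjInv_eq hsurj])] }
  have hlam'' : ∀ y, lam'' (cohomologyMap (ρ.mkQHom N hN) 2 y) = lam' y := fun y =>
    h3b _ _ (surjInv_eq hsurj _)
  -- Step 4: the line case for `M/N`
  obtain ⟨h, hh, hhW⟩ := hline (M ⧸ N) (ρ.quotient N hN) htriv hcard lam''
  -- conclusion: `f_M + π^D h`
  let fπ : HomCarrier M Ω := (homRepMap ω (ρ.mkQHom N hN)).hom h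
  have hfπ : ∀ g : G, ρ.homRep ω g fπ = fπ := homRepMap_invariant ω (ρ.mkQHom N hN) h hh
  have hsum : ∀ g : G, ρ.homRep ω g (fM + fπ) = fM + fπ := fun g => by
    rw [map_add]
    exact congrArg₂ (· + ·) (hfM g) (hfπ g)
  refine ⟨fM + fπ, hsum, AddMonoidHom.ext fun y => ?_⟩
  have e1 := twoZero_add ρ ω ι fM fπ hfM hfπ hsum y
  have e2 : ρ.twoZero ω ι fπ hfπ y = lam' y :=
    (twoZero_map ω ι (ρ.mkQHom N hN) h hh hfπ y).symm.trans
      ((congrArg (fun φ : continuousCohomology 2 (ρ.quotient N hN).toTopRep →+ ZMod n =>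
        φ (cohomologyMap (ρ.mkQHom N hN) 2 y)) hhW).trans (hlam'' y))
  calc ρ.twoZero ω ι (fM + fπ) hsum y = ρ.twoZero ω ι fM hfM y + ρ.twoZero ω ι fπ hfπ y := e1
    _ = ρ.twoZero ω ι fM hfM y + lam' y := by rw [e2]
    _ = lam y := by rw [hlam', AddMonoidHom.sub_apply, add_sub_cancel]

end Devissage

end ContinuousRep

end Literature.NumberTheory.GaloisRepresentations

end
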